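import Literature.NumberTheory.Automorphic.SymplecticSatakeTransformDuality
import HarnessLib

/-!
# The Satake isomorphism for `SL₂ = Sp₂` over ANY commutative ring: the counting transform maps
# `ℋ(Sp₂(K), Sp₂(𝒪); R)` isomorphically onto `{f ∈ R[x^{±1}] : f_{-k} = [t_k B(𝒪) t_k⁻¹ : B(𝒪)] · f_k (k ≥ 0)}`
# (Cartier Thm. 4.1 in rank one; Macdonald V (3.4); Satake 1963)

Topic `NumberTheory/Automorphic`; namespace `Literature.NumberTheory.Automorphic.SymplecticCartan` (lane `lit-hodgefound`,
Track 2 foundations; seat `lit-hodgefound-p11`, generation 44, row g44-#8).  THEOREMS ONLY: no definition, no named fact, no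
instance, no notation.  Sequel of `SymplecticSatakeTransformDuality` (g44-#4: the `w₀`-symmetry of `𝒮_1(T)` for every `T`)
in the case `n = 1` (`Sp₂ = SL₂`, Weyl group `W = {1, w₀}`), combined with the tree's injectivity
(`satakeTransform_symplectic_injective_of_commRing`), dominance (`sum_symplecticIwasawaExp_head_le`) and unique top coset
(`coeff_self_satakeTransform_symplectic_cartanDiagonal`).

## The mathematics

For `n = 1`, `Λ = ℤ¹`, `W = {±1}`, and g44-#4 gives for every `T ∈ ℋ = ℋ(Sp₂(K), Sp₂(𝒪); R)` and every `m ≤ 0`: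
`𝒮_1(T)_m = D(m) · 𝒮_1(T)_{-m}`, `D(m) = [t_m B(𝒪) t_m⁻¹ : B(𝒪) ∩ t_mB(𝒪)t_m⁻¹]` (`t_m = diag(ϖ^m; ϖ^{-m})`; for `m ≤ 0` an
honest index `[B(𝒪) : t_m⁻¹...]`-type number, `= q^{-2m}` classically).  So the image of the COUNTING transform
`𝒮_1 : ℋ →ₐ[R] R[ℤ¹]` lies in the `R`-submodule

  `V = {f : ∀ m ≤ 0, f_m = D(m) f_{-m}}`   (`range_satakeTransform_one_subset_rank_one`),

and conversely (`mem_range_satakeTransform_one_of_rank_one`) **every `f ∈ V` is a transform**: `V` has the `R`-basis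
`b_0 = 1`, `b_k = x^k + D(-k) x^{-k}` (`k ≥ 1`), and `𝒮_1(T_{d(k)})` (`d(k) = diag(ϖ^k; ϖ^{-k})`) lies in `V`, is supported on
exponents `≤ k` (Bruhat–Tits dominance) and has coefficient `1` at `x^k` (unique top coset), so `𝒮_1(T_{d(k)}) = b_k + (lower)`
and induction on `k` exhausts `V`.  With the tree's injectivity: **`𝒮_1 : ℋ(Sp₂(K), Sp₂(𝒪); R) ⥲ V` is an isomorphism of
`R`-algebras for every commutative ring `R`** (`range_satakeTransform_one_rank_one`, `satakeTransform_symplectic_injective_of_commRing`)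
— Cartier's Theorem 4.1 («`S` is an isomorphism onto `ℂ[Λ]^W`») for `SL₂` with the `W`-action twisted by the modulus
(the counting normalisation; over `R ∋ q^{±1/2}` the twist `x^m ↦ q^{m} x^m` untwists it to honest `W`-invariants).

## What is formalised (theorems only; `n = 1`)

* §1 `eq_const_of_fin_one` (`μ = (μ 0)`), `antitone_const_fin`, `coe_diagonal_pow_const_eq_diagonal_zpow`,
  `coeff_satakeTransform_one_cartan_eq_zero_of_lt` (support of `𝒮_1(T_{d(k)})` is `≤ k`),
  `coeff_satakeTransform_one_cartan_self` (top coefficient `1`).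
* §2 **`range_satakeTransform_one_subset_rank_one`** (`𝒮_1(T) ∈ V`), **`mem_range_satakeTransform_one_of_rank_one`**
  (`V ⊆ range`), **`range_satakeTransform_one_rank_one`** (`range 𝒮_1 = V`), `satakeTransform_one_bijective_rank_one`
  (bijection `ℋ → V`).

## References
* [CartierCorvallis1979] P. Cartier, *Representations of 𝔭-adic groups: a survey*, PSPM 33.1 (1979), §IV (4.2), Thm. 4.1.
* [Macdonald1995] I. G. Macdonald, *Symmetric Functions and Hall Polynomials*, 2nd ed. (1995), Ch. V (2.6)–(2.9), (3.4).
* [Satake1963] I. Satake, *Theory of spherical functions on reductive algebraic groups over 𝔭-adic fields*, Publ. Math. IHÉS 18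
  (1963), §§6–7.
* [BruhatTits1972] F. Bruhat, J. Tits, *Groupes réductifs sur un corps local I*, Publ. Math. IHÉS 41 (1972), (4.4.4).
-/

noncomputable section

open scoped Valued WithZero Pointwise
open Matrix MonoidAlgebra Representation Finset MulAction ConjAct

namespace Literature.NumberTheory.Automorphic.SymplecticCartan

open Literature.NumberTheory.Automorphic.CartanUnique Literature.NumberTheory.Automorphic.HermitianLattice

variable {K : Type*} [Field K] [Valued K ℤᵐ⁰] {ϖ : K}

/-! ## §1 Rank one: exponents are scalars; support and top coefficient of `𝒮_1(T_{d(k)})` -/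

omit [Valued K ℤᵐ⁰] in
/-- In rank one every exponent is constant: `μ = (μ 0)`. [cite: Macdonald1995, Ch. V (2.6)] -/
theorem eq_const_of_fin_one (μ : Fin 1 → ℤ) : μ = fun _ => μ 0 :=
  funext fun i => congrArg μ (Subsingleton.elim i 0)

omit [Valued K ℤᵐ⁰] in
/-- A constant function on `Fin 1` is antitone. [cite: Macdonald1995, Ch. V (2.6)] -/
theorem antitone_const_fin (k : ℕ) : Antitone (fun _ : Fin 1 => k) := fun _ _ _ => le_rfl

omit [Valued K ℤᵐ⁰] in
/-- The Cartan representative `d(k) = diag(ϖ^k; ϖ^{-k})` in the normal form `diagonal (ϖ^{(k; -k)})` of g44-#4.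
[cite: Macdonald1995, Ch. V (2.6)] -/
theorem coe_diagonal_pow_const_eq_diagonal_zpow (hϖ0 : ϖ ≠ 0) (k : ℕ) :
    ((⟨Matrix.diagonal (Sum.elim (fun _ : Fin 1 => ϖ ^ k) (fun _ : Fin 1 => (ϖ ^ k)⁻¹)),
        diagonal_pow_mem_symplecticGroup hϖ0 (fun _ : Fin 1 => k)⟩ : symplecticGroup (Fin 1) K) :
        Matrix (Fin 1 ⊕ Fin 1) (Fin 1 ⊕ Fin 1) K) =
      Matrix.diagonal fun s => ϖ ^ Sum.elim (fun _ : Fin 1 => (k : ℤ)) (-fun _ : Fin 1 => (k : ℤ)) s :=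
  coe_diagonal_pow_eq_diagonal_zpow hϖ0 fun _ : Fin 1 => k

section RankOne

variable {R : Type*} [CommRing R] (hϖ : Valued.v ϖ = WithZero.exp (-1 : ℤ))
  [IsHeckeTriple (⊤ : Submonoid (symplecticGroup (Fin 1) K)) (symplecticInt (Fin 1) K) (symplecticInt (Fin 1) K)]
include hϖ

/-- **Support of `𝒮_1(T_{d(k)})`**: the coefficient of `x^μ` vanishes for `μ 0 > k` (Bruhat–Tits dominance in rank one).
[cite: BruhatTits1972, Prop. (4.4.4) (i)] [cite: Macdonald1995, Ch. V (2.6)] -/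
theorem coeff_satakeTransform_one_cartan_eq_zero_of_lt (k : ℕ) {μ : Fin 1 → ℤ} (hμ : (k : ℤ) < μ 0) :
    ((isIwasawaExponent_symplectic (n := 1) hϖ).satakeTransform (1 : Multiplicative (Fin 1 → ℤ) →* R)
        (heckeAlgebra.doubleCosetOperator (symplecticInt (Fin 1) K)
          (⟨Matrix.diagonal (Sum.elim (fun _ : Fin 1 => ϖ ^ k) (fun _ : Fin 1 => (ϖ ^ k)⁻¹)),
            diagonal_pow_mem_symplecticGroup (uniformizer_ne_zero hϖ) (fun _ : Fin 1 => k)⟩ :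
              symplecticGroup (Fin 1) K))).coeff μ = 0 := by
  refine (isIwasawaExponent_symplectic hϖ).coeff_satakeTransform_doubleCosetOperator_eq_zero 1 fun α hα he => ?_
  have hα' : (α.out : symplecticGroup (Fin 1) K ⧸ symplecticInt (Fin 1) K) ∈ MulAction.orbit (symplecticInt (Fin 1) K)
      (((⟨Matrix.diagonal (Sum.elim (fun _ : Fin 1 => ϖ ^ k) (fun _ : Fin 1 => (ϖ ^ k)⁻¹)),
          diagonal_pow_mem_symplecticGroup (uniformizer_ne_zero hϖ) (fun _ : Fin 1 => k)⟩ : symplecticGroup (Fin 1) K)) :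
        symplecticGroup (Fin 1) K ⧸ symplecticInt (Fin 1) K) := by
    rwa [QuotientGroup.out_eq']
  have h := sum_symplecticIwasawaExp_head_le hϖ (antitone_const_fin k) hα' 1
  have e1 : (∑ i : Fin 1, if (i : ℕ) < 1 then symplecticIwasawaExp hϖ α.out i else 0) = symplecticIwasawaExp hϖ α.out 0 := by
    rw [Fin.sum_univ_one, if_pos (by decide)]
  have e2 : ((∑ i : Fin 1, if (i : ℕ) < 1 then k else 0 : ℕ) : ℤ) = k := by
    rw [Fin.sum_univ_one, if_pos (by decide)]
  rw [e1, e2, he] at h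
  exact absurd hμ (not_lt.2 h)

/-- **Top coefficient**: the coefficient of `x^k` in `𝒮_1(T_{d(k)})` is `1` (the unique top coset).
[cite: BruhatTits1972, Prop. (4.4.4) (ii)] [cite: CartierCorvallis1979, §IV, proof of Thm. 4.1 (c)] -/
theorem coeff_satakeTransform_one_cartan_self (k : ℕ) :
    ((isIwasawaExponent_symplectic (n := 1) hϖ).satakeTransform (1 : Multiplicative (Fin 1 → ℤ) →* R)
        (heckeAlgebra.doubleCosetOperator (symplecticInt (Fin 1) K)
          (⟨Matrix.diagonal (Sum.elim (fun _ : Fin 1 => ϖ ^ k) (fun _ : Fin 1 => (ϖ ^ k)⁻¹)),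
            diagonal_pow_mem_symplecticGroup (uniformizer_ne_zero hϖ) (fun _ : Fin 1 => k)⟩ :
              symplecticGroup (Fin 1) K))).coeff (fun _ : Fin 1 => (k : ℤ)) = 1 := by
  rw [coeff_self_satakeTransform_symplectic_cartanDiagonal hϖ 1 (antitone_const_fin k), MonoidHom.one_apply]

/-! ## §2 The image of `𝒮_1` is `V = {f : f_m = D(m) f_{-m} (m ≤ 0)}` -/

/-- **`𝒮_1(T) ∈ V`**: for every `T` and every `m ≤ 0`, `𝒮_1(T)_m = 𝒮_1(T)_{-m} · [t_mB(𝒪)t_m⁻¹ : B(𝒪) ∩ t_mB(𝒪)t_m⁻¹]`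
(g44-#4 in rank one). [cite: CartierCorvallis1979, §IV Thm. 4.1] [cite: Macdonald1995, Ch. V (3.4)] -/
theorem range_satakeTransform_one_subset_rank_one
    (T : heckeAlgebra R (symplecticGroup (Fin 1) K) (symplecticInt (Fin 1) K)) {m : ℤ} (hm : m ≤ 0) :
    ((isIwasawaExponent_symplectic (n := 1) hϖ).satakeTransform (1 : Multiplicative (Fin 1 → ℤ) →* R) T).coeff
        (fun _ : Fin 1 => m) =
      ((isIwasawaExponent_symplectic (n := 1) hϖ).satakeTransform (1 : Multiplicative (Fin 1 → ℤ) →* R) T).coeff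
          (fun _ : Fin 1 => -m) *
        (((toConjAct (⟨Matrix.diagonal fun s => ϖ ^ Sum.elim (fun _ : Fin 1 => m) (-fun _ : Fin 1 => m) s,
              diagonal_mem_symplecticGroup (zpow_elim_inl_mul_inr (uniformizer_ne_zero hϖ) fun _ : Fin 1 => m)⟩ :
                symplecticGroup (Fin 1) K) •
            (symplecticBorel 1 K ⊓ symplecticInt (Fin 1) K)).relIndex (symplecticBorel 1 K ⊓ symplecticInt (Fin 1) K) : ℕ) : R) := by
  have h := coeff_satakeTransform_one_eq_relIndex_mul_symplectic (R := R) hϖ T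
    (t := (⟨Matrix.diagonal fun s => ϖ ^ Sum.elim (fun _ : Fin 1 => m) (-fun _ : Fin 1 => m) s,
      diagonal_mem_symplecticGroup (zpow_elim_inl_mul_inr (uniformizer_ne_zero hϖ) fun _ : Fin 1 => m)⟩ :
        symplecticGroup (Fin 1) K)) (μ := fun _ : Fin 1 => m) rfl (fun _ _ _ => le_rfl) (fun _ => hm)
  exact h

/-- **`V ⊆ range 𝒮_1`**: every `f ∈ R[ℤ¹]` with `f_m = D(m) f_{-m}` for all `m ≤ 0` is the counting transform of some `T`
(induction on the top exponent: `𝒮_1(T_{d(k)}) = x^k + (lower) ∈ V`). [cite: CartierCorvallis1979, §IV, proof of Thm. 4.1 (c)]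
[cite: Macdonald1995, Ch. V (2.6)–(2.9), (3.4)] -/
theorem mem_range_satakeTransform_one_of_rank_one (f : AddMonoidAlgebra R (Fin 1 → ℤ))
    (hf : ∀ m : ℤ, m ≤ 0 → f.coeff (fun _ : Fin 1 => m) = f.coeff (fun _ : Fin 1 => -m) *
      (((toConjAct (⟨Matrix.diagonal fun s => ϖ ^ Sum.elim (fun _ : Fin 1 => m) (-fun _ : Fin 1 => m) s,
              diagonal_mem_symplecticGroup (zpow_elim_inl_mul_inr (uniformizer_ne_zero hϖ) fun _ : Fin 1 => m)⟩ :
                symplecticGroup (Fin 1) K) •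
            (symplecticBorel 1 K ⊓ symplecticInt (Fin 1) K)).relIndex (symplecticBorel 1 K ⊓ symplecticInt (Fin 1) K) : ℕ) : R)) :
    f ∈ Set.range ((isIwasawaExponent_symplectic (n := 1) hϖ).satakeTransform (1 : Multiplicative (Fin 1 → ℤ) →* R)) := by
  classical
  -- abbreviations: the transform, the index `D`, the representative `d(k)`
  set 𝒮 := (isIwasawaExponent_symplectic (n := 1) hϖ).satakeTransform (1 : Multiplicative (Fin 1 → ℤ) →* R) with h𝒮
  -- induction on the top exponent
  suffices key : ∀ (k : ℕ) (g : AddMonoidAlgebra R (Fin 1 → ℤ)),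
      (∀ m : ℤ, m ≤ 0 → g.coeff (fun _ : Fin 1 => m) = g.coeff (fun _ : Fin 1 => -m) *
        (((toConjAct (⟨Matrix.diagonal fun s => ϖ ^ Sum.elim (fun _ : Fin 1 => m) (-fun _ : Fin 1 => m) s,
              diagonal_mem_symplecticGroup (zpow_elim_inl_mul_inr (uniformizer_ne_zero hϖ) fun _ : Fin 1 => m)⟩ :
                symplecticGroup (Fin 1) K) •
            (symplecticBorel 1 K ⊓ symplecticInt (Fin 1) K)).relIndex (symplecticBorel 1 K ⊓ symplecticInt (Fin 1) K) : ℕ) : R)) →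
      (∀ μ : Fin 1 → ℤ, (k : ℤ) < μ 0 → g.coeff μ = 0) → g ∈ Set.range 𝒮 by
    -- the top exponent of `f`
    refine key (f.coeff.support.sup fun μ => (μ 0).toNat) f hf fun μ hμ => ?_
    by_contra hne
    have hmem : μ ∈ f.coeff.support := Finsupp.mem_support_iff.2 hne
    have hle : (μ 0).toNat ≤ f.coeff.support.sup fun μ => (μ 0).toNat := Finset.le_sup (f := fun μ => (μ 0).toNat) hmem
    have := Int.self_le_toNat (μ 0)
    omega
  intro k
  induction k with
  | zero =>
    intro g hg hsupp
    -- `g` is the constant `g_0`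
    refine ⟨algebraMap R _ (g.coeff 0), ?_⟩
    rw [AlgHom.commutes, Algebra.algebraMap_eq_smul_one, AddMonoidAlgebra.one_def]
    refine AddMonoidAlgebra.ext (Finsupp.ext fun μ => ?_)
    rw [AddMonoidAlgebra.coeff_smul, Finsupp.smul_apply, AddMonoidAlgebra.coeff_single, Finsupp.single_apply, smul_eq_mul]
    by_cases hμ0 : (0 : Fin 1 → ℤ) = μ
    · rw [if_pos hμ0, mul_one, ← hμ0]
    · rw [if_neg hμ0, mul_zero]
      have hμ : μ 0 ≠ 0 := fun h => hμ0 (by rw [eq_const_of_fin_one μ, h]; rfl)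
      rcases lt_or_gt_of_ne hμ with hlt | hgt
      · -- negative exponent: use `V`
        rw [eq_const_of_fin_one μ, hg (μ 0) hlt.le, hsupp (fun _ => -μ 0) (by push_cast; omega), zero_mul]
      · exact (hsupp μ (by exact_mod_cast hgt)).symm
  | succ k ih =>
    intro g hg hsupp
    -- subtract the transform of `T_{d(k+1)}`
    set c : R := g.coeff (fun _ : Fin 1 => ((k + 1 : ℕ) : ℤ)) with hc
    set S := 𝒮 (heckeAlgebra.doubleCosetOperator (symplecticInt (Fin 1) K)
      (⟨Matrix.diagonal (Sum.elim (fun _ : Fin 1 => ϖ ^ (k + 1)) (fun _ : Fin 1 => (ϖ ^ (k + 1))⁻¹)),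
        diagonal_pow_mem_symplecticGroup (uniformizer_ne_zero hϖ) (fun _ : Fin 1 => k + 1)⟩ : symplecticGroup (Fin 1) K)) with hS
    have hSV : ∀ m : ℤ, m ≤ 0 → S.coeff (fun _ : Fin 1 => m) = S.coeff (fun _ : Fin 1 => -m) *
        (((toConjAct (⟨Matrix.diagonal fun s => ϖ ^ Sum.elim (fun _ : Fin 1 => m) (-fun _ : Fin 1 => m) s,
              diagonal_mem_symplecticGroup (zpow_elim_inl_mul_inr (uniformizer_ne_zero hϖ) fun _ : Fin 1 => m)⟩ :
                symplecticGroup (Fin 1) K) •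
            (symplecticBorel 1 K ⊓ symplecticInt (Fin 1) K)).relIndex (symplecticBorel 1 K ⊓ symplecticInt (Fin 1) K) : ℕ) : R) :=
      fun m hm => range_satakeTransform_one_subset_rank_one hϖ _ hm
    obtain ⟨T', hT'⟩ := ih (g - c • S) (fun m hm => by
        simp only [AddMonoidAlgebra.coeff_sub, AddMonoidAlgebra.coeff_smul, Finsupp.sub_apply, Finsupp.smul_apply, smul_eq_mul]
        rw [hg m hm, hSV m hm]
        ring)
      (fun μ hμ => by
        simp only [AddMonoidAlgebra.coeff_sub, AddMonoidAlgebra.coeff_smul, Finsupp.sub_apply, Finsupp.smul_apply, smul_eq_mul]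
        rcases lt_or_eq_of_le (show ((k + 1 : ℕ) : ℤ) ≤ μ 0 by push_cast; omega) with hlt | heq
        · rw [hsupp μ hlt, hS, coeff_satakeTransform_one_cartan_eq_zero_of_lt hϖ (k + 1) hlt, mul_zero, sub_zero]
        · have hμ' : μ = fun _ : Fin 1 => ((k + 1 : ℕ) : ℤ) := by rw [eq_const_of_fin_one μ, ← heq]
          rw [hμ', hS, coeff_satakeTransform_one_cartan_self hϖ (k + 1), mul_one, ← hc, sub_self])
    refine ⟨T' + c • heckeAlgebra.doubleCosetOperator (symplecticInt (Fin 1) K)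
      (⟨Matrix.diagonal (Sum.elim (fun _ : Fin 1 => ϖ ^ (k + 1)) (fun _ : Fin 1 => (ϖ ^ (k + 1))⁻¹)),
        diagonal_pow_mem_symplecticGroup (uniformizer_ne_zero hϖ) (fun _ : Fin 1 => k + 1)⟩ : symplecticGroup (Fin 1) K), ?_⟩
    rw [map_add, map_smul, hT', ← hS, sub_add_cancel]

/-- **THE SATAKE ISOMORPHISM FOR `SL₂ = Sp₂` OVER ANY COMMUTATIVE RING** (image): the range of the counting transform
`𝒮_1 : ℋ(Sp₂(K), Sp₂(𝒪); R) → R[ℤ¹]` is exactly `V = {f : f_m = [t_mB(𝒪)t_m⁻¹ : B(𝒪) ∩ t_mB(𝒪)t_m⁻¹] · f_{-m} (m ≤ 0)}`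
— the `w₀`-invariants twisted by the modulus; with `satakeTransform_symplectic_injective_of_commRing`, `𝒮_1 : ℋ ⥲ V`.
[cite: CartierCorvallis1979, §IV Thm. 4.1] [cite: Satake1963, §§6–7] [cite: Macdonald1995, Ch. V (3.4)] -/
theorem range_satakeTransform_one_rank_one :
    Set.range ((isIwasawaExponent_symplectic (n := 1) hϖ).satakeTransform (1 : Multiplicative (Fin 1 → ℤ) →* R)) =
      {f | ∀ m : ℤ, m ≤ 0 → f.coeff (fun _ : Fin 1 => m) = f.coeff (fun _ : Fin 1 => -m) *
        (((toConjAct (⟨Matrix.diagonal fun s => ϖ ^ Sum.elim (fun _ : Fin 1 => m) (-fun _ : Fin 1 => m) s,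
              diagonal_mem_symplecticGroup (zpow_elim_inl_mul_inr (uniformizer_ne_zero hϖ) fun _ : Fin 1 => m)⟩ :
                symplecticGroup (Fin 1) K) •
            (symplecticBorel 1 K ⊓ symplecticInt (Fin 1) K)).relIndex (symplecticBorel 1 K ⊓ symplecticInt (Fin 1) K) : ℕ) : R)} := by
  ext f
  constructor
  · rintro ⟨T, rfl⟩ _ hm
    exact range_satakeTransform_one_subset_rank_one hϖ T hm
  · exact fun hf => mem_range_satakeTransform_one_of_rank_one hϖ f hf

/-- **`𝒮_1` is a bijection from `ℋ(Sp₂(K), Sp₂(𝒪); R)` onto `V`** (injective by the tree, surjective onto `V` by the above):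
the Satake isomorphism for `SL₂` over every commutative ring `R`. [cite: CartierCorvallis1979, §IV Thm. 4.1]
[cite: Satake1963, §§6–7] -/
theorem satakeTransform_one_bijective_rank_one :
    Function.Bijective (fun T : heckeAlgebra R (symplecticGroup (Fin 1) K) (symplecticInt (Fin 1) K) =>
      (⟨(isIwasawaExponent_symplectic (n := 1) hϖ).satakeTransform (1 : Multiplicative (Fin 1 → ℤ) →* R) T,
        fun _ hm => range_satakeTransform_one_subset_rank_one hϖ T hm⟩ :
        {f : AddMonoidAlgebra R (Fin 1 → ℤ) // ∀ m : ℤ, m ≤ 0 → f.coeff (fun _ : Fin 1 => m) = f.coeff (fun _ : Fin 1 => -m) *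
          (((toConjAct (⟨Matrix.diagonal fun s => ϖ ^ Sum.elim (fun _ : Fin 1 => m) (-fun _ : Fin 1 => m) s,
                diagonal_mem_symplecticGroup (zpow_elim_inl_mul_inr (uniformizer_ne_zero hϖ) fun _ : Fin 1 => m)⟩ :
                  symplecticGroup (Fin 1) K) •
              (symplecticBorel 1 K ⊓ symplecticInt (Fin 1) K)).relIndex (symplecticBorel 1 K ⊓ symplecticInt (Fin 1) K) : ℕ) : R)})) := by
  refine ⟨fun T T' h => satakeTransform_symplectic_injective_of_commRing hϖ 1 (congrArg Subtype.val h), fun f => ?_⟩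
  obtain ⟨T, hT⟩ := mem_range_satakeTransform_one_of_rank_one hϖ f.1 f.2
  exact ⟨T, Subtype.ext hT⟩

end RankOne

end Literature.NumberTheory.Automorphic.SymplecticCartan

end
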